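import Summits.Ventures.HodgeRepro2.T5SU11LegendreWronskian
import Summits.Ventures.HodgeRepro2.T5SU11LegendreSeriesIntegrate
import Summits.Ventures.HodgeRepro2.T5SU11LegendreSeriesRateC6

/-!
# The Legendre chapter, summary VI: termwise integration, the `C⁶` rate, the moments, and the Legendre functions
of the second kind (Neumann's integral, the equation, the series, positivity, the asymptotics, the Wronskian)

One entry point, under uniform names, for rows 433–439 (files `T5SU11LegendreSeriesIntegrate`, `…SecondKind`,
`…SecondKindODE`, `…SeriesRateC6`, `…Moments`, `…SecondKindSeries`, `…Wronskian`), plus one new corollary: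

  **`P_n` and `Q_n` are linearly independent on `(1, ∞)`**   (`linearIndependent_legP_legQ2`):
  if `a P_n + b Q_n = 0` on `(1, ∞)` then `a = b = 0` (the Wronskian is non-zero).

Nothing is claimed about (N).

Blind lane: Mathlib + the HodgeRepro2 prefix only; no sorry; axioms ⊆ {propext, Classical.choice,
Quot.sound}.
-/

namespace Summit.Ventures.HodgeRepro2.T5SU11LegendreSummaryVI

open Polynomial intervalIntegral Finset Filter Topology MeasureTheory
open Set (Icc Ioi Ioo)
open T5SU11SphericalLegendreAll T5SU11JacobiPhaseLawEven T5SU11JacobiLegendreLeading T5SU11LegendreIdentities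
  T5SU11LegendreSeries T5SU11LegendreSeriesIntegrate T5SU11LegendreSeriesRateC6 T5SU11LegendreMoments
  T5SU11LegendreSecondKind T5SU11LegendreSecondKindODE T5SU11LegendreSecondKindSeries T5SU11LegendreWronskian

/-! ### Termwise integration and the `C⁶` rate (rows 433, 436) -/

/-- The integrated Legendre series of a continuous `f` converges uniformly to `∫_{−1}^{x} f` (row 433). -/
theorem integrated_series {f : ℝ → ℝ} (hf : ContinuousOn f (Icc (-1 : ℝ) 1)) :
    TendstoUniformlyOn (fun d x => fourierLegendre f 0 * (x + 1)
        + ∑ k ∈ range d, fourierLegendre f (k + 1) * ((legP (k + 2) x - legP k x) / (2 * (k : ℝ) + 3)))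
      (fun x => ∫ t in (-1 : ℝ)..x, f t) atTop (Icc (-1 : ℝ) 1) :=
  tendstoUniformlyOn_integratedSum hf

/-- The rate `O(d⁻⁵)` for `f ∈ C⁶(ℝ)` (row 436). -/
theorem rate_C6 {f : ℝ → ℝ} (hf : ContDiff ℝ 6 f) {d : ℕ} (hd : 1 ≤ d) {x : ℝ} (hx : x ∈ Icc (-1 : ℝ) 1) :
    |f x - partialSum f d x|
      ≤ Real.sqrt (∫ x in (-1 : ℝ)..1,
          sturm3 (deriv f) (deriv^[2] f) (deriv^[3] f) (deriv^[4] f) (deriv^[5] f) (deriv^[6] f) x ^ 2)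
        / (d : ℝ) ^ 5 :=
  abs_sub_partialSum_le_div_pow_five_of_contDiff hf hd hx

/-! ### The moments (row 437) -/

/-- The moment formula `∫ t^m P_n = (m!/(m − n)!)/(2ⁿ n!) ∫ t^{m−n} (1 − t²)ⁿ` (row 437). -/
theorem moments (m n : ℕ) :
    ∫ t in (-1 : ℝ)..1, t ^ m * legP n t
      = (m.descFactorial n : ℝ) / ((2 : ℝ) ^ n * n.factorial)
        * ∫ t in (-1 : ℝ)..1, t ^ (m - n) * (1 - t ^ 2) ^ n :=
  integral_pow_mul_legP m n

/-- `∫ tⁿ P_n = 2ⁿ⁺¹ (n!)²/(2n + 1)!` (row 437). -/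
theorem moments_first (n : ℕ) :
    ∫ t in (-1 : ℝ)..1, t ^ n * legP n t = 2 ^ (n + 1) * (n.factorial : ℝ) ^ 2 / ((2 * n + 1).factorial : ℝ) :=
  integral_pow_self_mul_legP' n

/-- The moments are positive for `m ≥ n` with `m − n` even, and vanish for `m + n` odd (row 437). -/
theorem moments_sign {m n : ℕ} :
    (n ≤ m → Even (m - n) → 0 < ∫ t in (-1 : ℝ)..1, t ^ m * legP n t)
      ∧ (Odd (m + n) → ∫ t in (-1 : ℝ)..1, t ^ m * legP n t = 0) :=
  ⟨fun h he => integral_pow_mul_legP_pos h he, fun h => integral_pow_mul_legP_eq_zero_of_odd h⟩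

/-! ### The Legendre functions of the second kind (rows 434, 435, 438, 439) -/

/-- `Q_0(x) = ½ log((x + 1)/(x − 1))` for `x > 1` (row 434). -/
theorem secondKind_zero {x : ℝ} (hx : 1 < x) : legQ2 0 x = (1 / 2) * Real.log ((x + 1) / (x - 1)) := legQ2_zero hx

/-- Bonnet's recursion for `Q_n` (row 434). -/
theorem secondKind_recursion (n : ℕ) {x : ℝ} (hx : 1 < x) :
    ((n : ℝ) + 2) * legQ2 (n + 2) x = (2 * (n : ℝ) + 3) * x * legQ2 (n + 1) x - ((n : ℝ) + 1) * legQ2 n x :=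
  legQ2_succ_succ n hx

/-- Christoffel's form `Q_n = ½ P_n log((x + 1)/(x − 1)) − W_n` (row 434). -/
theorem secondKind_christoffel (n : ℕ) {x : ℝ} (hx : 1 < x) :
    legQ2 n x = (1 / 2) * legP n x * Real.log ((x + 1) / (x - 1)) - (legW n).eval x :=
  legQ2_eq_log n hx

/-- `Q_n` solves Legendre's equation on `(1, ∞)` (row 435). -/
theorem secondKind_ode (n : ℕ) {x : ℝ} (hx : 1 < x) :
    (1 - x ^ 2) * legQ2'' n x - 2 * x * legQ2' n x + (n : ℝ) * ((n : ℝ) + 1) * legQ2 n x = 0 :=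
  legendre_ode_legQ2 n hx

/-- `Q_n` is differentiable on `(1, ∞)` with derivative `Q′_n`, and `Q′_n` with derivative `Q″_n` (row 435). -/
theorem secondKind_hasDerivAt (n : ℕ) {x : ℝ} (hx : 1 < x) :
    HasDerivAt (legQ2 n) (legQ2' n x) x ∧ HasDerivAt (legQ2' n) (legQ2'' n x) x :=
  ⟨hasDerivAt_legQ2 n hx, hasDerivAt_legQ2' n hx⟩

/-- `Q_n(x) > 0` and `Q′_n(x) < 0` for `x > 1` (rows 438, 439). -/
theorem secondKind_pos_neg (n : ℕ) {x : ℝ} (hx : 1 < x) : 0 < legQ2 n x ∧ legQ2' n x < 0 :=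
  ⟨legQ2_pos n hx, legQ2'_neg n hx⟩

/-- `Q_n` is strictly decreasing on `(1, ∞)` (row 439). -/
theorem secondKind_antitone (n : ℕ) : StrictAntiOn (legQ2 n) (Ioi 1) := strictAntiOn_legQ2 n

/-- The asymptotics `x^{n+1} Q_n(x) → 1/((2n + 1) lc_n)` and `x^{n+2} Q′_n(x) → −(n + 1)/((2n + 1) lc_n)`
(rows 438, 439). -/
theorem secondKind_asymptotic (n : ℕ) :
    Tendsto (fun x => x ^ (n + 1) * legQ2 n x) atTop (𝓝 (1 / ((2 * (n : ℝ) + 1) * legLead n)))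
      ∧ Tendsto (fun x => x ^ (n + 2) * legQ2' n x) atTop
          (𝓝 (-(((n : ℝ) + 1) / ((2 * (n : ℝ) + 1) * legLead n)))) :=
  ⟨tendsto_pow_mul_legQ2 n, tendsto_pow_mul_legQ2' n⟩

/-- The Wronskian `P_n Q′_n − P′_n Q_n = 1/(1 − x²)` on `(1, ∞)` (row 439). -/
theorem wronskian (n : ℕ) {x : ℝ} (hx : 1 < x) : legP n x * legQ2' n x - legQ n x * legQ2 n x = 1 / (1 - x ^ 2) :=
  legP_mul_legQ2'_sub_legQ_mul_legQ2 n hx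

/-! ### Linear independence -/

/-- **`P_n` and `Q_n` are linearly independent on `(1, ∞)`**: if `a P_n + b Q_n = 0` there, then `a = b = 0`. -/
theorem linearIndependent_legP_legQ2 (n : ℕ) {a b : ℝ} (h : ∀ x, 1 < x → a * legP n x + b * legQ2 n x = 0) :
    a = 0 ∧ b = 0 := by
  -- differentiate the identity at `x₀ = 2`
  have hx : (1 : ℝ) < 2 := by norm_num
  have hd : HasDerivAt (fun x => a * legP n x + b * legQ2 n x) (a * legQ n 2 + b * legQ2' n 2) 2 :=
    ((hasDerivAt_legP n 2).const_mul a).add ((hasDerivAt_legQ2 n hx).const_mul b)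
  have h0 : HasDerivAt (fun x => a * legP n x + b * legQ2 n x) 0 2 := by
    have : (fun x => a * legP n x + b * legQ2 n x) =ᶠ[𝓝 (2 : ℝ)] fun _ => (0 : ℝ) := by
      filter_upwards [Ioi_mem_nhds hx] with y hy
      exact h y hy.out
    exact (hasDerivAt_const (2 : ℝ) (0 : ℝ)).congr_of_eventuallyEq this
  have hderiv : a * legQ n 2 + b * legQ2' n 2 = 0 := hd.unique h0
  have hval : a * legP n 2 + b * legQ2 n 2 = 0 := h 2 hx
  have hW := wronskian n hx
  have hWne : legP n 2 * legQ2' n 2 - legQ n 2 * legQ2 n 2 ≠ 0 := by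
    rw [hW]
    norm_num
  have hQ := legQ2_pos n hx
  -- `a · W = 0` from the two relations
  have ha : a * (legP n 2 * legQ2' n 2 - legQ n 2 * legQ2 n 2) = 0 := by
    linear_combination (legQ2' n 2) * hval - (legQ2 n 2) * hderiv
  have ha0 : a = 0 := by
    rcases mul_eq_zero.mp ha with h1 | h1
    · exact h1
    · exact absurd h1 hWne
  refine ⟨ha0, ?_⟩
  rw [ha0, zero_mul, zero_add] at hval
  rcases mul_eq_zero.mp hval with h1 | h1
  · exact h1
  · exact absurd h1 hQ.ne'

end Summit.Ventures.HodgeRepro2.T5SU11LegendreSummaryVI
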